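import Summits.NavierStokesRegularity.FunctionalMining.TopEigHeatConvex
import Summits.NavierStokesRegularity.FunctionalMining.CrossedShearField
import HarnessLib

/-!
# FunctionalMining — the rate of Lemma L-λ cannot exceed the first-shell value `q (2π)²`

Search for candidate a priori estimates; no regularity claim. Cell `pub-nsfunc`, prove seat
(gen 17). A kernel calibration of the dictionary's OPEN node `TopEigHeatCoercive q c`
(`c · ∫(λ₁⁺)^q ≤ heatDissipation` on smooth zero-mean divergence-free fields of `T³`): on the
single-shell crossed shear `u = (sin 2πx₁, sin 2πx₀, 0) = csField E₀ E₀` (`E₀ = expP 0 ≡ 1`,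
`CrossedShearField`) one has `Δu = −4π²u`, so by the gen-16 calibration
`heatDissipation (∫(λ₁⁺)^q) u = q · 4π² · ∫(λ₁⁺)^q(u)` (`TopEig.heatDissipation_topEigMoment_of_laplacian_eq`),
and `∫(λ₁⁺)^q(u) > 0` (`λ₁ ≥ eᵀSe = π(cos 2πx₀ + cos 2πx₁)` with `e = (1,1,0)/√2`, positive at the
origin). Hence

* `TopEig.topEigHeatCoercive_rate_le` — `TopEigHeatCoercive q c → c ≤ 4π² q` (`q ≥ 1`), and the same for
  the `−λ₃` core (`TopEig.negBotEigHeatCoercive_rate_le`, `e = (1,−1,0)/√2`): the dictionary's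
  "single-shell value `R_q = qK`" (SIEVELD §3.4b; `(2π)²·q·1` on the unit torus) as a kernel upper bound
  for the best rate in Lemma L-λ(q). (Numerically the nogo seat's descent gives `inf R₂ ≤ 0.58·(2π)²`;
  nothing sharper is claimed here.) [ours, calibration]
-/

noncomputable section

open MeasureTheory Set Filter Topology Finset Real
open scoped InnerProductSpace RealInnerProductSpace

namespace Summit.NavierStokesRegularity.FunctionalMining

open Literature.Analysis Literature.Analysis.FunctionSpaces Literature.Analysis.FunctionSpaces.Torus
  Literature.Analysis.FluidPDE

namespace TopEig

open CrossedShear StrainL4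

/-! ## 1. The constant profile `E₀ = expP 0 ≡ 1` and the single-shell crossed shear -/

/-- `E₀ ≡ 1` on the circle. [ours, bookkeeping] -/
theorem expP_zero_onCircle (b : UnitAddCircle) : (expP 0).onCircle b = 1 := by
  induction b using QuotientAddGroup.induction_on
  rw [ShearProfile.onCircle_coe, expP_apply, zero_mul, Real.exp_zero]

/-- `E₀' = 0` as a function. [ours, bookkeeping] -/
theorem deriv_expP_zero : deriv (expP 0 : ℝ → ℝ) = fun _ => 0 := by
  funext t
  rw [deriv_expP]
  ring

/-- `E₀' ≡ 0` on the circle. [ours, bookkeeping] -/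
theorem expP_zero_D_onCircle (b : UnitAddCircle) : (expP 0).D.onCircle b = 0 := by
  induction b using QuotientAddGroup.induction_on
  rw [ShearProfile.onCircle_coe, ShearProfile.D_apply, deriv_expP_zero]

/-- `E₀'' ≡ 0` on the circle. [ours, bookkeeping] -/
theorem expP_zero_DD_onCircle (b : UnitAddCircle) : (expP 0).D.D.onCircle b = 0 := by
  induction b using QuotientAddGroup.induction_on
  rw [ShearProfile.onCircle_coe, ShearProfile.D_apply, ShearProfile.coe_D, deriv_expP_zero]
  simp

/-- **`Δ u = −4π² u`** for the single-shell crossed shear `u = csField E₀ E₀`. [ours, calibration] -/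
theorem laplacian_csField_expP_zero :
    Torus.laplacian (csField (expP 0) (expP 0)) = -((4 * π ^ 2) • csField (expP 0) (expP 0)) := by
  rw [laplacian_csField]
  funext x
  have h0 : f0 (lapProfile (expP 0)) x = -(4 * π ^ 2) * f0 (expP 0) x := by
    simp only [f0, lapProfile_onCircle, expP_zero_onCircle, expP_zero_DD_onCircle]
    ring
  have h1 : f1 (lapProfile (expP 0)) x = -(4 * π ^ 2) * f1 (expP 0) x := by
    simp only [f1, lapProfile_onCircle, expP_zero_onCircle, expP_zero_DD_onCircle]
    ring
  simp only [csField, Pi.neg_apply, Pi.smul_apply, h0, h1, smul_add, smul_smul, neg_add]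
  rw [← neg_smul, ← neg_smul]
  congr 1 <;> ring_nf

/-! ## 2. The top and bottom strain eigenvalues of the crossed shear dominate `π(C(x₀) + C(x₁))` -/

/-- The off-diagonal strain entry: `S₀₁ = S₁₀ = π (C(x₁) + C(x₀))`, the diagonal and the third row /
column vanish. [ours, elementary] -/
theorem strainFlat_csField_expP_zero (x : UnitAddTorus (Fin 3)) :
    strainFlat (csField (expP 0) (expP 0)) x (0, 1) = π * (cosP.onCircle (x 1) + cosP.onCircle (x 0)) ∧
    strainFlat (csField (expP 0) (expP 0)) x (1, 0) = π * (cosP.onCircle (x 1) + cosP.onCircle (x 0)) ∧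
    strainFlat (csField (expP 0) (expP 0)) x (0, 0) = 0 ∧
    strainFlat (csField (expP 0) (expP 0)) x (1, 1) = 0 ∧
    strainFlat (csField (expP 0) (expP 0)) x (0, 2) = 0 ∧
    strainFlat (csField (expP 0) (expP 0)) x (2, 0) = 0 ∧
    strainFlat (csField (expP 0) (expP 0)) x (1, 2) = 0 ∧
    strainFlat (csField (expP 0) (expP 0)) x (2, 1) = 0 ∧
    strainFlat (csField (expP 0) (expP 0)) x (2, 2) = 0 := by
  obtain ⟨h00, h01, h02, h10, h11, h12, h20, h21, h22⟩ :=
    partialDeriv_csField_table (expP 0) (expP 0) x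
  simp only [strainFlat_apply, h00, h01, h02, h10, h11, h12, h20, h21, h22, expP_zero_onCircle,
    expP_zero_D_onCircle]
  refine ⟨?_, ?_, ?_, ?_, ?_, ?_, ?_, ?_, ?_⟩ <;> ring

/-- `λ₁(x) ≥ π (C(x₀) + C(x₁))` (Rayleigh quotient at `e = (1, 1, 0)/√2`). [ours, elementary] -/
theorem topEig_csField_ge (x : UnitAddTorus (Fin 3)) :
    π * (cosP.onCircle (x 1) + cosP.onCircle (x 0)) ≤ torusStrainTopEig (csField (expP 0) (expP 0)) x := by
  obtain ⟨h01, h10, h00, h11, h02, h20, h12, h21, h22⟩ := strainFlat_csField_expP_zero x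
  set e : Fin 3 → ℝ := ![1 / Real.sqrt 2, 1 / Real.sqrt 2, 0] with he
  have hs : Real.sqrt 2 * Real.sqrt 2 = 2 := Real.mul_self_sqrt (by norm_num)
  have hs2 : (1 / Real.sqrt 2) * (1 / Real.sqrt 2) = 1 / 2 := by
    rw [div_mul_div_comm, one_mul, hs]
  have hunit : e ⬝ᵥ e = 1 := by
    simp only [he, dotProduct, Fin.sum_univ_three, Matrix.cons_val_zero, Matrix.cons_val_one,
      Matrix.cons_val_two, Matrix.tail_cons, Matrix.head_cons]
    nlinarith [hs2]
  have hq := quad_le_lam (strainFlat (csField (expP 0) (expP 0)) x) hunit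
  rw [lam_strainFlat] at hq
  have hquad : quad (strainFlat (csField (expP 0) (expP 0)) x) e =
      π * (cosP.onCircle (x 1) + cosP.onCircle (x 0)) := by
    simp only [quad, Fin.sum_univ_three, he, Matrix.cons_val_zero, Matrix.cons_val_one,
      Matrix.cons_val_two, Matrix.tail_cons, Matrix.head_cons, h01, h10, h00, h11, h02, h20, h12,
      h21, h22]
    linear_combination (2 * (π * (cosP.onCircle (x 1) + cosP.onCircle (x 0)))) * hs2
  rw [hquad] at hq
  exact hq

/-- `−λ₃(x) ≥ π (C(x₀) + C(x₁))` (Rayleigh quotient of `−S` at `e = (1, −1, 0)/√2`). [ours, elementary] -/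
theorem negBotEig_csField_ge (x : UnitAddTorus (Fin 3)) :
    π * (cosP.onCircle (x 1) + cosP.onCircle (x 0)) ≤ -torusStrainBotEig (csField (expP 0) (expP 0)) x := by
  obtain ⟨h01, h10, h00, h11, h02, h20, h12, h21, h22⟩ := strainFlat_csField_expP_zero x
  set e : Fin 3 → ℝ := ![1 / Real.sqrt 2, -(1 / Real.sqrt 2), 0] with he
  have hs : Real.sqrt 2 * Real.sqrt 2 = 2 := Real.mul_self_sqrt (by norm_num)
  have hs2 : (1 / Real.sqrt 2) * (1 / Real.sqrt 2) = 1 / 2 := by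
    rw [div_mul_div_comm, one_mul, hs]
  have hunit : e ⬝ᵥ e = 1 := by
    simp only [he, dotProduct, Fin.sum_univ_three, Matrix.cons_val_zero, Matrix.cons_val_one,
      Matrix.cons_val_two, Matrix.tail_cons, Matrix.head_cons]
    nlinarith [hs2]
  have hq := quad_le_lam (-strainFlat (csField (expP 0) (expP 0)) x) hunit
  rw [lam_neg_strainFlat] at hq
  have hquad : quad (-strainFlat (csField (expP 0) (expP 0)) x) e =
      π * (cosP.onCircle (x 1) + cosP.onCircle (x 0)) := by
    simp only [quad, Fin.sum_univ_three, he, Matrix.cons_val_zero, Matrix.cons_val_one,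
      Matrix.cons_val_two, Matrix.tail_cons, Matrix.head_cons, PiLp.neg_apply, h01, h10, h00, h11,
      h02, h20, h12, h21, h22]
    linear_combination (2 * (π * (cosP.onCircle (x 1) + cosP.onCircle (x 0)))) * hs2
  rw [hquad] at hq
  exact hq

/-! ## 3. The moments are positive -/

/-- The comparison density `(π(C(x₀)+C(x₁)))⁺^q` has positive integral (continuous, non-negative, and
`= (2π)^q > 0` at the origin). [ours, elementary] -/
theorem integral_model_pos {q : ℝ} (hq : 0 ≤ q) :
    0 < ∫ x : UnitAddTorus (Fin 3), max (π * (cosP.onCircle (x 1) + cosP.onCircle (x 0))) 0 ^ q := by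
  have hx1 : Continuous fun x : UnitAddTorus (Fin 3) => cosP.onCircle (x 1) :=
    cosP.continuous_onCircle.comp (continuous_apply (1 : Fin 3))
  have hx0 : Continuous fun x : UnitAddTorus (Fin 3) => cosP.onCircle (x 0) :=
    cosP.continuous_onCircle.comp (continuous_apply (0 : Fin 3))
  have hc : Continuous fun x : UnitAddTorus (Fin 3) =>
      max (π * (cosP.onCircle (x 1) + cosP.onCircle (x 0))) 0 ^ q :=
    ((continuous_const.mul (hx1.add hx0)).max continuous_const).rpow_const fun _ => Or.inr hq
  have h0 : ∀ x : UnitAddTorus (Fin 3), 0 ≤ max (π * (cosP.onCircle (x 1) + cosP.onCircle (x 0))) 0 ^ q :=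
    fun x => Real.rpow_nonneg (le_max_right _ _) _
  rw [integral_pos_iff_support_of_nonneg h0 (hc.integrable_of_hasCompactSupport
    (HasCompactSupport.of_compactSpace _))]
  set xs : UnitAddTorus (Fin 3) := fun _ => ((0 : ℝ) : UnitAddCircle) with hxs
  refine (hc.isOpen_support).measure_pos volume ⟨xs, ?_⟩
  rw [Function.mem_support]
  have hC : cosP.onCircle ((0 : ℝ) : UnitAddCircle) = 1 := by
    rw [ShearProfile.onCircle_coe, cosP_apply, mul_zero, Real.cos_zero]
  show max (π * (cosP.onCircle ((0 : ℝ) : UnitAddCircle) + cosP.onCircle ((0 : ℝ) : UnitAddCircle))) 0 ^ q ≠ 0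
  rw [hC, max_eq_left (by positivity)]
  exact (Real.rpow_pos_of_pos (by positivity) _).ne'

/-- **`∫(λ₁⁺)^q(u) > 0`** for the single-shell crossed shear (`q ≥ 0`). [ours] -/
theorem torusTopEigMoment_csField_pos {q : ℝ} (hq : 0 ≤ q) :
    0 < torusTopEigMoment q (csField (expP 0) (expP 0)) := by
  have hu : IsSmooth (csField (expP 0) (expP 0)) := isSmooth_csField _ _
  have hc : Continuous fun x => max (torusStrainTopEig (csField (expP 0) (expP 0)) x) 0 ^ q := by
    have h1 : Continuous fun x => lam (strainFlat (csField (expP 0) (expP 0)) x) :=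
      continuous_lam.comp (continuous_strainFlat hu)
    have e : (fun x => torusStrainTopEig (csField (expP 0) (expP 0)) x) =
        fun x => lam (strainFlat (csField (expP 0) (expP 0)) x) := funext fun x => (lam_strainFlat _ x).symm
    have h2 : Continuous fun x => torusStrainTopEig (csField (expP 0) (expP 0)) x := by rw [e]; exact h1
    exact (h2.max continuous_const).rpow_const fun _ => Or.inr hq
  refine lt_of_lt_of_le (integral_model_pos hq) ?_
  exact integral_mono_of_nonneg (ae_of_all _ fun x => Real.rpow_nonneg (le_max_right _ _) _)
    hc.integrable_unitAddTorus (ae_of_all _ fun x => posPart_rpow_mono hq (topEig_csField_ge x))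

/-- **`∫((−λ₃)⁺)^q(u) > 0`** for the single-shell crossed shear (`q ≥ 0`). [ours] -/
theorem torusNegBotEigMoment_csField_pos {q : ℝ} (hq : 0 ≤ q) :
    0 < torusNegBotEigMoment q (csField (expP 0) (expP 0)) := by
  have hu : IsSmooth (csField (expP 0) (expP 0)) := isSmooth_csField _ _
  have hc : Continuous fun x => max (-torusStrainBotEig (csField (expP 0) (expP 0)) x) 0 ^ q := by
    have h1 : Continuous fun x => lam (-strainFlat (csField (expP 0) (expP 0)) x) :=
      continuous_lam.comp (continuous_strainFlat hu).neg
    have e : (fun x => -torusStrainBotEig (csField (expP 0) (expP 0)) x) =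
        fun x => lam (-strainFlat (csField (expP 0) (expP 0)) x) :=
      funext fun x => (lam_neg_strainFlat _ x).symm
    have h2 : Continuous fun x => -torusStrainBotEig (csField (expP 0) (expP 0)) x := by rw [e]; exact h1
    exact (h2.max continuous_const).rpow_const fun _ => Or.inr hq
  refine lt_of_lt_of_le (integral_model_pos hq) ?_
  exact integral_mono_of_nonneg (ae_of_all _ fun x => Real.rpow_nonneg (le_max_right _ _) _)
    hc.integrable_unitAddTorus (ae_of_all _ fun x => posPart_rpow_mono hq (negBotEig_csField_ge x))

/-! ## 4. The rate bound -/

/-- **The rate of Lemma L-λ(q) is at most the first-shell value: `TopEigHeatCoercive q c → c ≤ 4π² q`**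
(`q ≥ 1`; witness: the single-shell crossed shear, where `heatDissipation = q·4π²·∫(λ₁⁺)^q` exactly).
[ours, calibration] -/
theorem topEigHeatCoercive_rate_le {q c : ℝ} (hq : 1 ≤ q) (h : TopEigHeatCoercive (d := Fin 3) q c) :
    c ≤ 4 * π ^ 2 * q := by
  have hu : IsSmooth (csField (expP 0) (expP 0)) := isSmooth_csField _ _
  have hcal := heatDissipation_topEigMoment_of_laplacian_eq hq (by positivity : (0 : ℝ) ≤ 4 * π ^ 2) hu
    laplacian_csField_expP_zero
  have hL := h (by simp) (csField (expP 0) (expP 0)) hu (isDivFree_csField _ _) (hasZeroMean_csField _ _)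
  rw [hcal] at hL
  have hpos := torusTopEigMoment_csField_pos (q := q) (by linarith)
  have : c ≤ q * (4 * π ^ 2) := le_of_mul_le_mul_right (by linarith) hpos
  linarith

/-- **The same for the `−λ₃` core: `NegBotEigHeatCoercive q c → c ≤ 4π² q`** (`q ≥ 1`). [ours, calibration] -/
theorem negBotEigHeatCoercive_rate_le {q c : ℝ} (hq : 1 ≤ q)
    (h : NegBotEigHeatCoercive (d := Fin 3) q c) : c ≤ 4 * π ^ 2 * q := by
  have hu : IsSmooth (csField (expP 0) (expP 0)) := isSmooth_csField _ _
  have hcal := heatDissipation_negBotEigMoment_of_laplacian_eq hq (by positivity : (0 : ℝ) ≤ 4 * π ^ 2)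
    hu laplacian_csField_expP_zero
  have hL := h (by simp) (csField (expP 0) (expP 0)) hu (isDivFree_csField _ _) (hasZeroMean_csField _ _)
  rw [hcal] at hL
  have hpos := torusNegBotEigMoment_csField_pos (q := q) (by linarith)
  have : c ≤ q * (4 * π ^ 2) := le_of_mul_le_mul_right (by linarith) hpos
  linarith

/-- Consequently the dictionary's `TopEigHeatCoercivePos q` (`∃ c > 0`) can only be witnessed by rates
`c ∈ (0, 4π²q]`; no `c > 4π² q` works. [ours, calibration] -/
theorem not_topEigHeatCoercive_of_lt {q c : ℝ} (hq : 1 ≤ q) (hc : 4 * π ^ 2 * q < c) :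
    ¬ TopEigHeatCoercive (d := Fin 3) q c := fun h =>
  absurd (topEigHeatCoercive_rate_le hq h) (not_le.2 hc)

end TopEig

end Summit.NavierStokesRegularity.FunctionalMining

end
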